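import Summits.CriticalPhenomena.CardyFormulaZ2.Theorems.CardyBoundaryCoulombGasHalfPlaneMarkDensityLawSelfDualityExact
import Literature.Probability.Percolation.ClusterBoundary

/-!
# `HalfPlaneMarkDensityLaw` (crux stmt-CriticalPhenomena-5661), line `Sketch`, cycle 4 (`Positivity`), lead c12-0:
# stub Q8' `stub_firstHit_decoupling_of` — decoupling by the law of the `H`-cluster

With `NL(k; lo, hi)` = "the nearest bottom point `t < k` of the `H`-cluster of `(k,0)` lies in `[lo,hi]`":
if every escape crossing `[t+1,hi]×{0} ↔ [cl,k−1]×{0}` in `H` has probability `≤ q`, then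
`(1 − q)·P[NL(k; lo, hi)] ≤ P[firstHit halfPlane ([lo,hi]×{0}) cl k]`.
Proof: sum over the (a.s. finite) value `S` of the `H`-cluster (the cluster of `(k,0)` in the configuration
restricted to the edges of `H`): the events `{H-cluster = S}` are pairwise disjoint, determined by the edges
touching `S`, hence independent of the escape event off `S` (hypothesis Q6); on `{H-cluster = S} ∖ escape`
the first-hit event holds (hypothesis Q4); and the escape event off `S` is contained in the plain escape
crossing, of probability `≤ q`.
-/

noncomputable section

namespace Summit.CriticalPhenomena.CardyFormulaZ2.Cruxes.HalfPlaneMarkDensityLaw.SketchLine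

open Literature.Probability.Percolation Literature.Probability.LatticeModels
open MeasureTheory Filter Set SimpleGraph
open scoped Topology ENNReal
open Summit.CriticalPhenomena.CardyFormulaZ2.Theorems.HalfPlaneMarkDensityLaw.Negative

namespace Positivity

/-- `DeterminedBy` is preserved by indexed unions (over sets of indices). [folklore] -/
theorem determinedBy_biUnion' {ι κ : Type*} {s : Set κ} {A : κ → Set (Set ι)} {F : Set ι}
    (h : ∀ i ∈ s, DeterminedBy (A i) F) : DeterminedBy (⋃ i ∈ s, A i) F := by
  rw [determinedBy_iff]
  intro ω ω' hF
  simp only [Set.mem_iUnion]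
  exact exists_congr fun i => exists_congr fun hi => (determinedBy_iff _ _).1 (h i hi) ω ω' hF

/-- The escape event off `S` (open path of `H` off `S` from `[t+1,hi]×{0}` to `[cl,k−1]×{0}`) is
determined by the pairs off `S`. [folklore] -/
theorem determinedBy_escape (S : Finset (Site 2)) (t hi cl k : ℤ) :
    DeterminedBy (⋃ u ∈ rowIcc (t + 1) hi, ⋃ v ∈ rowIcc cl (k - 1),
        (openConnIn (halfPlane ∩ (↑S : Set (Site 2))ᶜ) u v : Set (BondConfig (Site 2))))
      ((↑S : Set (Site 2))ᶜ).sym2 := by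
  refine determinedBy_biUnion' fun u _ => determinedBy_biUnion' fun v _ => ?_
  refine DCT16.determinedBy_openConnIn _ u v fun e he => ?_
  rw [Set.mem_sym2_iff_subset] at he ⊢
  exact fun w hw => (he hw).2

/-- The escape event off `S` is measurable. [folklore] -/
theorem measurableSet_escape (S : Finset (Site 2)) (t hi cl k : ℤ) :
    MeasurableSet (⋃ u ∈ rowIcc (t + 1) hi, ⋃ v ∈ rowIcc cl (k - 1),
        (openConnIn (halfPlane ∩ (↑S : Set (Site 2))ᶜ) u v : Set (BondConfig (Site 2)))) := by
  classical
  refine MeasurableSet.biUnion (Set.to_countable _) fun u _ => ?_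
  refine MeasurableSet.biUnion (Set.to_countable _) fun v _ => ?_
  exact (isFinitary_openConnIn _ u v).measurableSet (isUpperSet_openConnIn _ u v)

/-- The escape event off `S` is contained in the plain escape crossing of `H`. [folklore] -/
theorem escape_subset (S : Finset (Site 2)) (t hi cl k : ℤ) :
    (⋃ u ∈ rowIcc (t + 1) hi, ⋃ v ∈ rowIcc cl (k - 1),
        (openConnIn (halfPlane ∩ (↑S : Set (Site 2))ᶜ) u v : Set (BondConfig (Site 2)))) ⊆
      openCrossing halfPlane (rowIcc (t + 1) hi) (rowIcc cl (k - 1)) := by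
  intro ω hω
  simp only [Set.mem_iUnion] at hω
  obtain ⟨u, hu, v, hv, h⟩ := hω
  exact ⟨u, hu, v, hv, openConnIn_mono Set.inter_subset_left u v h⟩

/-- **Stub Q8' (glue).**  Q4–Q7 give the decoupling inequality
`(1 − q)·P[NL(k; lo, hi)] ≤ P[firstHit halfPlane ([lo,hi]×{0}) cl k]`. [folklore] -/
theorem stub_firstHit_decoupling_of :
    (∀ (ω : BondConfig (Site 2)) (S : Finset (Site 2)) (k t lo hi cl : ℤ), ω ⊆ (zdGraph 2).edgeSet → lo ≤ t → t ≤ hi → hi < cl → cl ≤ k → bpt t ∈ S → (∀ s : ℤ, t < s → s < k → bpt s ∉ S) → ω ∈ {ω : BondConfig (Site 2) | openCluster (ω ∩ {e : Sym2 (Site 2) | ∀ v ∈ e, v ∈ halfPlane}) (bpt (k)) = ↑S} → ω ∉ (⋃ u ∈ rowIcc (t + 1) hi, ⋃ v ∈ rowIcc cl (k - 1), (openConnIn (halfPlane ∩ (↑S : Set (Site 2))ᶜ) u v : Set (BondConfig (Site 2)))) → ω ∈ firstHit halfPlane (rowIcc lo hi) cl k) →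
    (∀ (ω : BondConfig (Site 2)) (k : ℤ) (v : Site 2), v ∈ openCluster (ω ∩ {e : Sym2 (Site 2) | ∀ v ∈ e, v ∈ halfPlane}) (bpt k) ↔ ω ∈ openConnIn halfPlane (bpt k) v) →
    (∀ (k : ℤ) (S : Finset (Site 2)) (B : Set (BondConfig (Site 2))), DeterminedBy B ((↑S : Set (Site 2))ᶜ).sym2 → MeasurableSet B → μ.real ({ω : BondConfig (Site 2) | openCluster (ω ∩ {e : Sym2 (Site 2) | ∀ v ∈ e, v ∈ halfPlane}) (bpt (k)) = ↑S} ∩ B) = μ.real {ω : BondConfig (Site 2) | openCluster (ω ∩ {e : Sym2 (Site 2) | ∀ v ∈ e, v ∈ halfPlane}) (bpt (k)) = ↑S} * μ.real B) →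
    (∀ (k : ℤ) (S : Finset (Site 2)), MeasurableSet {ω : BondConfig (Site 2) | openCluster (ω ∩ {e : Sym2 (Site 2) | ∀ v ∈ e, v ∈ halfPlane}) (bpt (k)) = ↑S}) →
    ∀ (k lo hi cl : ℤ) (q : ℝ), lo ≤ hi → hi < cl → cl ≤ k → (∀ t : ℤ, lo ≤ t → t ≤ hi → μ.real (openCrossing halfPlane (rowIcc (t + 1) hi) (rowIcc cl (k - 1))) ≤ q) → (1 - q) * μ.real {ω : BondConfig (Site 2) | ∃ t : ℤ, lo ≤ t ∧ t ≤ hi ∧ ω ∈ openConnIn halfPlane (bpt (k)) (bpt t) ∧ ∀ s : ℤ, t < s → s < k → ω ∉ openConnIn halfPlane (bpt (k)) (bpt s)} ≤ μ.real (firstHit halfPlane (rowIcc lo hi) cl k) := by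
  intro hQ4 hK0 hQ6 hQ7 k lo hi cl q hlohi hhicl hclk hq
  classical
  -- vocabulary
  set EH : Set (Sym2 (Site 2)) := {e : Sym2 (Site 2) | ∀ v ∈ e, v ∈ halfPlane} with hEH
  set HC : Finset (Site 2) → Set (BondConfig (Site 2)) :=
    fun S => {ω : BondConfig (Site 2) | openCluster (ω ∩ EH) (bpt k) = ↑S} with hHC
  set good : Finset (Site 2) → Prop :=
    fun S => ∃ t : ℤ, lo ≤ t ∧ t ≤ hi ∧ bpt t ∈ S ∧ ∀ s : ℤ, t < s → s < k → bpt s ∉ S with hgood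
  set tOf : Finset (Site 2) → ℤ := fun S => if h : good S then h.choose else lo with htOf
  have tOf_spec : ∀ S, good S → lo ≤ tOf S ∧ tOf S ≤ hi ∧ bpt (tOf S) ∈ S ∧
      ∀ s : ℤ, tOf S < s → s < k → bpt s ∉ S := by
    intro S hS
    have : tOf S = hS.choose := by simp only [htOf, dif_pos hS]
    rw [this]
    exact hS.choose_spec
  set ESC : Finset (Site 2) → Set (BondConfig (Site 2)) := fun S =>
    ⋃ u ∈ rowIcc (tOf S + 1) hi, ⋃ v ∈ rowIcc cl (k - 1),
      (openConnIn (halfPlane ∩ (↑S : Set (Site 2))ᶜ) u v : Set (BondConfig (Site 2))) with hESC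
  set piece : Finset (Site 2) → Set (BondConfig (Site 2)) :=
    fun S => if good S then HC S ∩ (ESC S)ᶜ else ∅ with hpiece
  set cell : Finset (Site 2) → Set (BondConfig (Site 2)) :=
    fun S => if good S then HC S else ∅ with hcell
  set NL : Set (BondConfig (Site 2)) := {ω : BondConfig (Site 2) | ∃ t : ℤ, lo ≤ t ∧ t ≤ hi ∧
      ω ∈ openConnIn halfPlane (bpt k) (bpt t) ∧
      ∀ s : ℤ, t < s → s < k → ω ∉ openConnIn halfPlane (bpt k) (bpt s)} with hNL
  -- measurability and disjointness of the cells
  have hHCm : ∀ S, MeasurableSet (HC S) := fun S => hQ7 k S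
  have hHCdisj : Pairwise fun S T => Disjoint (HC S) (HC T) := by
    intro S T hST
    rw [Set.disjoint_left]
    intro ω hS hT
    simp only [hHC, Set.mem_setOf_eq] at hS hT
    exact hST (Finset.coe_inj.1 (hS.symm.trans hT))
  have hESCm : ∀ S, MeasurableSet (ESC S) := fun S => measurableSet_escape S _ hi cl k
  have hpiecem : ∀ S, MeasurableSet (piece S) := by
    intro S
    simp only [hpiece]
    split_ifs
    · exact (hHCm S).inter (hESCm S).compl
    · exact MeasurableSet.empty
  have hcellm : ∀ S, MeasurableSet (cell S) := by
    intro S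
    simp only [hcell]
    split_ifs
    · exact hHCm S
    · exact MeasurableSet.empty
  have hpiece_sub : ∀ S, piece S ⊆ HC S := by
    intro S
    simp only [hpiece]
    split_ifs
    · exact Set.inter_subset_left
    · exact Set.empty_subset _
  have hcell_sub : ∀ S, cell S ⊆ HC S := by
    intro S
    simp only [hcell]
    split_ifs
    · exact le_rfl
    · exact Set.empty_subset _
  have hpiecedisj : Pairwise fun S T => Disjoint (piece S) (piece T) :=
    fun S T hST => (hHCdisj hST).mono (hpiece_sub S) (hpiece_sub T)
  have hcelldisj : Pairwise fun S T => Disjoint (cell S) (cell T) :=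
    fun S T hST => (hHCdisj hST).mono (hcell_sub S) (hcell_sub T)
  -- (1) `NL ⊆ ⋃ cell` almost surely (finite clusters)
  have hNL_sub : ∀ᵐ ω ∂μ, ω ∈ NL → ω ∈ ⋃ S, cell S := by
    filter_upwards [SelfDual.ae_forall_finite_openCluster] with ω hfin hω
    obtain ⟨t, hlo, hthi, hconn, hnot⟩ := hω
    have hfinH : (openCluster (ω ∩ EH) (bpt k)).Finite :=
      (hfin (bpt k)).subset (openCluster_mono Set.inter_subset_left _)
    refine Set.mem_iUnion.2 ⟨hfinH.toFinset, ?_⟩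
    have hgoodS : good hfinH.toFinset := by
      refine ⟨t, hlo, hthi, ?_, ?_⟩
      · rw [Set.Finite.mem_toFinset]
        exact (hK0 ω k (bpt t)).2 hconn
      · intro s hs1 hs2 hmem
        rw [Set.Finite.mem_toFinset] at hmem
        exact hnot s hs1 hs2 ((hK0 ω k (bpt s)).1 hmem)
    simp only [hcell, if_pos hgoodS, hHC, Set.mem_setOf_eq]
    exact (Set.Finite.coe_toFinset hfinH).symm
  -- (2) `⋃ piece ⊆ firstHit` almost surely (lattice configurations)
  have hpiece_sub_first : ∀ᵐ ω ∂μ, ω ∈ (⋃ S, piece S) → ω ∈ firstHit halfPlane (rowIcc lo hi) cl k := by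
    have hae : ∀ᵐ ω ∂μ, ω ⊆ (zdGraph 2).edgeSet := by unfold μ; exact ae_subset_edgeSet _ _
    filter_upwards [hae] with ω hω hmem
    obtain ⟨S, hS⟩ := Set.mem_iUnion.1 hmem
    by_cases hg : good S
    · simp only [hpiece, if_pos hg] at hS
      obtain ⟨hHCω, hESCω⟩ := hS
      obtain ⟨h1, h2, h3, h4⟩ := tOf_spec S hg
      exact hQ4 ω S k (tOf S) lo hi cl hω h1 h2 hhicl hclk h3 h4 hHCω hESCω
    · simp [hpiece, if_neg hg] at hS
  -- complements of escape events are determined by the pairs off `S`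
  have hcomplDet : ∀ S, DeterminedBy (ESC S)ᶜ ((↑S : Set (Site 2))ᶜ).sym2 := by
    intro S
    have h := determinedBy_escape S (tOf S) hi cl k
    rw [determinedBy_iff] at h ⊢
    intro ω ω' hF
    rw [Set.mem_compl_iff, Set.mem_compl_iff, h ω ω' hF]
  -- (3) each piece has probability `≥ (1 - q) · P(cell)`
  have hpiece_ge : ∀ S, ENNReal.ofReal (1 - q) * μ (cell S) ≤ μ (piece S) := by
    intro S
    by_cases hg : good S
    · simp only [hpiece, hcell, if_pos hg]
      obtain ⟨h1, h2, -, -⟩ := tOf_spec S hg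
      have hind : μ.real (HC S ∩ (ESC S)ᶜ) = μ.real (HC S) * μ.real (ESC S)ᶜ :=
        hQ6 k S (ESC S)ᶜ (hcomplDet S) (hESCm S).compl
      have hesc : μ.real (ESC S) ≤ q :=
        (measureReal_mono (escape_subset S _ hi cl k)).trans (hq _ h1 h2)
      have hcompl : 1 - q ≤ μ.real (ESC S)ᶜ := by
        rw [measureReal_compl (hESCm S), probReal_univ]
        linarith
      have hreal : (1 - q) * μ.real (HC S) ≤ μ.real (HC S ∩ (ESC S)ᶜ) := by
        rw [hind, mul_comm]
        exact mul_le_mul_of_nonneg_left hcompl measureReal_nonneg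
      calc ENNReal.ofReal (1 - q) * μ (HC S)
          = ENNReal.ofReal ((1 - q) * μ.real (HC S)) := by
            rw [measureReal_def, ENNReal.ofReal_mul' ENNReal.toReal_nonneg,
              ENNReal.ofReal_toReal (measure_ne_top _ _)]
        _ ≤ ENNReal.ofReal (μ.real (HC S ∩ (ESC S)ᶜ)) := ENNReal.ofReal_le_ofReal hreal
        _ = μ (HC S ∩ (ESC S)ᶜ) := by rw [measureReal_def, ENNReal.ofReal_toReal (measure_ne_top _ _)]
    · simp [hpiece, hcell, if_neg hg]
  -- (4) sum over the law of the `H`-cluster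
  have hsum : ENNReal.ofReal (1 - q) * μ (⋃ S, cell S) ≤ μ (⋃ S, piece S) := by
    rw [measure_iUnion hcelldisj hcellm, measure_iUnion hpiecedisj hpiecem, ← ENNReal.tsum_mul_left]
    exact ENNReal.tsum_le_tsum hpiece_ge
  -- (5) back to real numbers
  have hU₁ : μ.real NL ≤ μ.real (⋃ S, cell S) := by
    simp only [measureReal_def]
    exact ENNReal.toReal_mono (measure_ne_top _ _) (measure_mono_ae hNL_sub)
  have hU₂ : μ.real (⋃ S, piece S) ≤ μ.real (firstHit halfPlane (rowIcc lo hi) cl k) := by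
    simp only [measureReal_def]
    exact ENNReal.toReal_mono (measure_ne_top _ _) (measure_mono_ae hpiece_sub_first)
  by_cases hq1 : 1 - q ≤ 0
  · exact le_trans (mul_nonpos_of_nonpos_of_nonneg hq1 measureReal_nonneg) measureReal_nonneg
  have hq1 : 0 < 1 - q := not_le.1 hq1
  have hmid : (1 - q) * μ.real (⋃ S, cell S) ≤ μ.real (⋃ S, piece S) := by
    have := ENNReal.toReal_mono (measure_ne_top _ _) hsum
    rwa [ENNReal.toReal_mul, ENNReal.toReal_ofReal hq1.le, ← measureReal_def, ← measureReal_def] at this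
  calc (1 - q) * μ.real NL ≤ (1 - q) * μ.real (⋃ S, cell S) := mul_le_mul_of_nonneg_left hU₁ hq1.le
    _ ≤ μ.real (⋃ S, piece S) := hmid
    _ ≤ _ := hU₂

end Positivity

end Summit.CriticalPhenomena.CardyFormulaZ2.Cruxes.HalfPlaneMarkDensityLaw.SketchLine
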